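import Summits.AtomisticToContinuum.Crystallization.Theorems.FrustratedLawDichotomyTwoShellRigidityOctaCellAt
import Summits.AtomisticToContinuum.Crystallization.Theorems.FrustratedLawDichotomyBondGraphWindows
import Summits.AtomisticToContinuum.Crystallization.Theorems.FrustratedLawDichotomyTwoShellRigidityLadderCap
import Summits.AtomisticToContinuum.Crystallization.Theorems.FrustratedLawDichotomyTwoShellRigidityProbeCovering

-- PART A of lens-5 g32 `TwoShellRigidityGaugedLadder.lean` (sha256 7a91fe068329bbfb…, 998 l ⇒ split A → B → C → D for the 400-line rule by prover hand 1,
-- gen 11, --supports stmt-AtomisticToContinuum-27623; declarations byte-identical): §1 residuals in the pattern frame / gauged directional fits, §2 the finite LINEAR statement of a rung (`RungLP`).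

/-!
# FrustratedLawDichotomy · `M = CappedRigidity` by a GAUGE-FIXED DIRECTIONAL LADDER — the relaxation-validity lemma
# (decomp-a2c, lens-5 «finite range + asymptotic regime + bridge», gen 32; critic row 452 (A)(a))

Critic row 452 (A)(a) asked lens-5 g32 for the generic «relaxation-validity» lemma turning each rung of the g31 contraction ladder
(`TwoShellRigidityLadder`, L-format of record for the M column) into «an LP-dual table + linear arithmetic», with the slack constants explicit,
and named the debt of g31's rungs: ONE quadratic slack `D²` AND the second-order rotation correction of the per-rung least-squares re-fit.
This file delivers the lemma for a variant of the ladder in which the second debt does not exist.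

## The gauge-fixed directional ladder

* Residuals are READ IN THE PATTERN FRAME of ONE isometry `A` (`resAt`): `x_u = A⁻¹((y(τu) − y i)/nn_i) − u` for the dozen,
  `c = A⁻¹((y m − y i)/nn_i) − (u + v)` for a cap `m` of the square with diagonal `(u, v)`.  Every distance window of `LinkIso ∧ Capped` is
  then the exact quadratic `|y_j − y_k|²/nn_i² = 1 + 2⟪e, δ⟫ + ‖δ‖²` (`bondSq`) — no rotation is linearised anywhere.
* A rung (`GRungAt`) keeps THE SAME `A` on both sides; the rotational zero modes are removed by a GAUGE CONDITION `Γ` on the shell residual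
  field carried as a hypothesis (recommended `lsGauge`: `Σ_u u × x_u = 0`, three linear equalities).  The isometry moves ONCE, at the entry
  (`RegaugeAt`; crude constants PROVED from the configuration-free `GaugeFix`, sharp ones = one g31-type LP) — that is the only place of the
  whole ladder where a rotation remainder is ever estimated.
* Tolerances are ONE-SIDED DIRECTIONAL bounds `⟪n, ·⟫ ≤ P.k` over a finite probe list `D` (`DirFit`, `GFitAt`; tuple `P = (a, aq, b, bq)` for
  dozen / caps / contact differences / cap-bond differences).  Euclidean control enters only through the covering constant of `D`
  (`Covers D ρ : ‖v‖ ≤ ρ · ⟪n, v⟫` for some `n ∈ D`): inside a rung for the quadratic atoms, and once at the terminal (`‖x_u‖ ≤ ρ·Q.1 < η`).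
* With the scale ratios `s_u = nn_{τu}/nn_i`, `t = nn_m/nn_i` as unknowns and `s²`, `‖δ‖²` as atoms every window is LINEAR (`Rows`, `ScaleBox`),
  so the certificate of a rung is the finite statement `RungLP` and its replay is, per output inequality, one linear combination of hypothesis
  rows — hand-2's `CapUniqueCert` class; no `Real.exp`, no square roots beyond constant coordinates.

## Contents

§1 `resAt`, `SqVert`, `IsCap`, `GFitAt`, `GEntryAt`, `GRungAt`, `GChainAt` · §2 `bondSq`, `Rows`, `ScaleBox`, `DirFit`, ★ `RungLP`, `Covers` ·
§3 ★ `gRungAt_of_rungLP : (‖z‖ = 1 on Pat) → 0 ≤ θ → 0 ≤ ρ → Covers Din ρ → RungLP Pat Din Dout Γ θ ρ P Q → GRungAt Pat Din Dout Γ θ P Q`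
(PROVED) · §4 chains (`RungLPChain`, `gChainAt_of_rungLPChain`), terminal (`cappedRigidityAt_of_gEntry`, `cappedRigidityBothAt_of_gEntry`) ·
§5 entry side: `noGauge`, (`CapAprioriAt` = g31's, opened), `gEntryAt_noGauge_of_coarse(')` (hand lane `R(K) ∧ CapApriori` IS an ungauged entry),
`RegaugeAt`, `gEntryAt_of_regauge`, `GaugeFix` (typed; `κ = √6` for `lsGauge`), `regaugeAt_of_gaugeFix` (PROVED, explicit constants) ·
§6 probes: `axisProbes` (`covers_axisProbes` ρ = √3 PROVED), `diagProbes`, `probes26` (norms ≤ 1 PROVED; `CoversProbes26` ρ = 1.1281 PROVED by name, hand-1 p824086),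
`probes26Q` (rational pairings with √2·x / √18·x; `CoversProbes26Q` ρ = 1 typed), `lsGauge`, `rungLP_nontrivial` (a rung is never vacuous),
`inner_vec3` & co. for replay files · §7 assembly: `cappedRigidityAt_of_gaugedLadder`, `GLadderCertAt`, `cappedRigidity_of_gaugedLadders`,
`kr2Shape_of_gaugedLadders`, `aperiodicFrustratedLawGap_of_gaugedLadders` (crux of 27623 BY NAME through the door),
`gEntryAt_fcc/hcp_of_coarse(_tri)` (reading B entry with no cap hypothesis, via hand-1's `capAprioriAt_…`, p824270), `coversProbes26` (:= hand-1's
`covers_probes26`, p824086), `GLadderCert26At`, `cappedRigidity_of_gaugedLadders26`, `aperiodicFrustratedLawGap_of_gaugedLadders26` (ρ discharged).  0 sorry; UNDECIDED Props are `def … : Prop`.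

## Numbers (instrument HOME/decomp-a2c-lens-5/g32/scripts/grung.py; θ = 1/100, 26 probes, lsGauge, ρ = 1.1281; NOT proofs)

fcc fixed point `(2.795, 3.896, 3.035, 3.548)·θ` ⇒ terminal `ρ·Q.1 = 0.0315 < 1/20`; fcc basin contains the gauged entries `(12, 28, 24, 40)θ`
(→ 11.8 → 6.9 → 3.7 → 2.92 → 2.81 → 2.795) and `(16, 36, 32, 52)θ` (→ 12.0 → 6.6 → 3.57 → …); hcp near the fixed point `(2.83, 4.00, 3.05, ·)θ`.
See NODE-g32.md §4 for the table and HOME/…/g32/scripts/logs/ for the runs.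
-/

noncomputable section

namespace Summit.AtomisticToContinuum.Crystallization.Theorems.FrustratedLawDichotomyTwoShellRigidityGaugedLadder

open Literature.Geometry.DiscreteGeometry
open Summit.AtomisticToContinuum.Crystallization.Theorems.FrustratedLawDichotomyTwoShellRigidityCut
open Summit.AtomisticToContinuum.Crystallization.Theorems.FrustratedLawDichotomyTwoShellRigidityCells
open Summit.AtomisticToContinuum.Crystallization.Theorems.FrustratedLawDichotomyBondGraphWindows
open Summit.AtomisticToContinuum.Crystallization.Theorems.FrustratedLawDichotomyTwoShellRigidityLadder (CapAprioriAt)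
open Summit.AtomisticToContinuum.Crystallization.Theorems.FrustratedLawDichotomyTwoShellRigidityLadderCap
  (capAprioriAt_fcc capAprioriAt_hcp capAprioriAt_trilateration_fcc capAprioriAt_trilateration_hcp)
open Summit.AtomisticToContinuum.Crystallization.Theorems.FrustratedLawDichotomyTwoShellRigidityProbeCovering (covers_probes26)
open scoped RealInnerProductSpace

/-! ## 1. Residuals read in the pattern frame; gauged directional fits (configuration level) -/

/-- The normalised residual of site `j` against the reference point `z`, READ IN THE PATTERN FRAME of the isometry `A`:
`A⁻¹((y j − y i)/nn_i) − z`.  Shell site: `j = τ u`, `z = u`; a cap `m` of the square with diagonal `(u, v)`: `j = m`, `z = u + v`. -/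
def resAt {N : ℕ} (y : Fin N → E3) (i : Fin N) (A : E3 ≃ₗᵢ[ℝ] E3) (j : Fin N) (z : E3) : E3 :=
  A.symm ((nearestDist y i)⁻¹ • (y j - y i)) - z

/-- `w` is a vertex of the pattern square with diagonal `(u, v)` — the clause of `Capped`, verbatim. -/
def SqVert {Pat : Finset E3} (u v w : ↥Pat) : Prop :=
  w = u ∨ w = v ∨ (dist (w : E3) (u : E3) = 1 ∧ dist (w : E3) (v : E3) = 1)

/-- `m` CAPS the square `(u, v)` of the link of `i`: `m ≠ i` is `θ`-bonded to the (images of the) four square vertices — the conclusion of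
`Capped θ Pat y i τ` for the pair `(u, v)`. -/
def IsCap (θ : ℝ) {Pat : Finset E3} {N : ℕ} (y : Fin N → E3) (i : Fin N) (τ : ↥Pat → Fin N) (u v : ↥Pat) (m : Fin N) : Prop :=
  m ≠ i ∧ ∀ w : ↥Pat, SqVert u v w → (bondGraph θ y).Adj m (τ w)

/-- **Gauged directional fit** of the capped dozen at `i` by the isometry `A`, tolerance tuple `P = (a, aq, b, bq)`, probe set `D`, gauge `Γ`:
for every probe `n ∈ D` the ONE-SIDED bounds (1) `⟪n, x_u⟫ ≤ a` on the twelve shell residuals `x_u = A⁻¹((y(τu) − y i)/nn_i) − u`,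
(2) `⟪n, c⟫ ≤ aq` on the residual `c = A⁻¹((y m − y i)/nn_i) − (u+v)` of EVERY cap `m` of every square `(u, v)`, (3) `⟪n, x_u − x_w⟫ ≤ b` on
contacts, (4) `⟪n, c − x_w⟫ ≤ bq` on cap bonds; AND (5) the gauge condition `Γ x` on the shell residual field.  (With `D` symmetric the bounds
are two-sided; with `D ⊇ {±e₁, ±e₂, ±e₃}` they are sup-norm boxes.)  The isometry is an EQUIVALENCE so that `A⁻¹` is available; `E3` being
finite-dimensional this loses nothing (`LinearIsometry.toLinearIsometryEquiv`). -/
def GFitAt (Pat : Finset E3) (D : List E3) (Γ : (↥Pat → E3) → Prop) (θ : ℝ) (P : ℝ × ℝ × ℝ × ℝ)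
    {N : ℕ} (y : Fin N → E3) (i : Fin N) (τ : ↥Pat → Fin N) (A : E3 ≃ₗᵢ[ℝ] E3) : Prop :=
  (∀ n ∈ D, ∀ u : ↥Pat, ⟪n, resAt y i A (τ u) u⟫ ≤ P.1) ∧
  (∀ n ∈ D, ∀ u v : ↥Pat, dist (u : E3) (v : E3) = Real.sqrt 2 → ∀ m : Fin N, IsCap θ y i τ u v m →
      ⟪n, resAt y i A m ((u : E3) + (v : E3))⟫ ≤ P.2.1) ∧
  (∀ n ∈ D, ∀ u w : ↥Pat, dist (u : E3) (w : E3) = 1 → ⟪n, resAt y i A (τ u) u - resAt y i A (τ w) w⟫ ≤ P.2.2.1) ∧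
  (∀ n ∈ D, ∀ u v : ↥Pat, dist (u : E3) (v : E3) = Real.sqrt 2 → ∀ m : Fin N, IsCap θ y i τ u v m → ∀ w : ↥Pat, SqVert u v w →
      ⟪n, resAt y i A m ((u : E3) + (v : E3)) - resAt y i A (τ w) w⟫ ≤ P.2.2.2) ∧
  Γ (fun u => resAt y i A (τ u) u)

/-- **Gauged entry** `GEntry(D, Γ, θ, P, Pat)`: every injective `7/10`-separated configuration whose link at `i` is `Pat`-isomorphic via `τ`
and capped admits an isometry `A` with a gauged directional fit of tolerance `P`. -/
def GEntryAt (Pat : Finset E3) (D : List E3) (Γ : (↥Pat → E3) → Prop) (θ : ℝ) (P : ℝ × ℝ × ℝ × ℝ) : Prop :=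
  ∀ (N : ℕ) (y : Fin N → E3) (i : Fin N) (τ : ↥Pat → Fin N), Function.Injective y →
    (∀ a b : Fin N, a ≠ b → (7 : ℝ) / 10 ≤ dist (y a) (y b)) → LinkIso θ Pat y i τ → Capped θ Pat y i τ →
      ∃ A : E3 ≃ₗᵢ[ℝ] E3, GFitAt Pat D Γ θ P y i τ A

/-- **Gauged rung** `GRung(Din → Dout, Γ, θ, P → Q, Pat)`: for THE SAME isometry `A`, a gauged `Din`-fit of tolerance `P` is a gauged
`Dout`-fit of tolerance `Q`.  No re-gauging, no new isometry: the rotational zero modes are killed by `Γ`, so the successor map is affine-linear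
and its certificate is a finite LP (`RungLP`, §2). -/
def GRungAt (Pat : Finset E3) (Din Dout : List E3) (Γ : (↥Pat → E3) → Prop) (θ : ℝ) (P Q : ℝ × ℝ × ℝ × ℝ) : Prop :=
  ∀ (N : ℕ) (y : Fin N → E3) (i : Fin N) (τ : ↥Pat → Fin N), Function.Injective y →
    (∀ a b : Fin N, a ≠ b → (7 : ℝ) / 10 ≤ dist (y a) (y b)) → LinkIso θ Pat y i τ → Capped θ Pat y i τ →
      ∀ A : E3 ≃ₗᵢ[ℝ] E3, GFitAt Pat Din Γ θ P y i τ A → GFitAt Pat Dout Γ θ Q y i τ A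

/-- A chain of gauged rungs `P → R₁ → ⋯ → R_k → Q` in one probe currency `D`. -/
def GChainAt (Pat : Finset E3) (D : List E3) (Γ : (↥Pat → E3) → Prop) (θ : ℝ) :
    ℝ × ℝ × ℝ × ℝ → List (ℝ × ℝ × ℝ × ℝ) → ℝ × ℝ × ℝ × ℝ → Prop
  | P, [], Q => GRungAt Pat D D Γ θ P Q
  | P, R :: L, Q => GRungAt Pat D D Γ θ P R ∧ GChainAt Pat D Γ θ R L Q

/-! ## 2. The finite LINEAR statement of a rung (`RungLP`) -/

/-- `1 + 2⟪e, δ⟫ + ‖δ‖²` — the squared normalised length of the bond `e + δ` when the reference bond `e` is a unit vector. -/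
def bondSq (e δ : E3) : ℝ := 1 + 2 * ⟪e, δ⟫ + ‖δ‖ ^ 2

/-- The two WINDOW ROWS of a bond of squared normalised length `E` at an endpoint of scale ratio `s = nn_endpoint / nn_i`:
`s² ≤ E` (own nearest-neighbour distance `≤` bond length) and `E ≤ (1+θ)² s²` (bond length `≤ (1+θ)·nn_endpoint`).
LINEAR in the atoms `⟪e, δ⟫`, `‖δ‖²`, `s`, `s²`. -/
def Rows (θ s E : ℝ) : Prop := s ^ 2 ≤ E ∧ E ≤ (1 + θ) ^ 2 * s ^ 2

/-- The SCALE BOX of an endpoint whose own nearest-neighbour distance is within the factor `κ` of `nn_i` (`κ = 1+θ` for shell sites,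
`(1+θ)²` for caps): `1 ≤ κ s`, `s ≤ κ`, and the chord `s² ≤ (κ⁻¹ + κ)·s − 1` (i.e. `(s − κ⁻¹)(s − κ) ≤ 0`; with `s² ≥ 2s − 1` for free this pins
the atom `s²` to within `O(θ²)` of `2s − 1`).  LINEAR in `s`, `s²`. -/
def ScaleBox (κ s : ℝ) : Prop := 1 ≤ κ * s ∧ s ≤ κ ∧ s ^ 2 ≤ (κ⁻¹ + κ) * s - 1

/-- Directional fit of FINITE data — shell residuals `x : Pat → E3` and ONE cap-residual slot `c u v` per ordered `√2`-pair `(u, v)` —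
with probe set `D` and tolerance tuple `P = (a, aq, b, bq)`; the finite twin of clauses (1)–(4) of `GFitAt`. -/
def DirFit {Pat : Finset E3} (D : List E3) (P : ℝ × ℝ × ℝ × ℝ) (x : ↥Pat → E3) (c : ↥Pat → ↥Pat → E3) : Prop :=
  (∀ n ∈ D, ∀ u : ↥Pat, ⟪n, x u⟫ ≤ P.1) ∧
  (∀ n ∈ D, ∀ u v : ↥Pat, dist (u : E3) (v : E3) = Real.sqrt 2 → ⟪n, c u v⟫ ≤ P.2.1) ∧
  (∀ n ∈ D, ∀ u w : ↥Pat, dist (u : E3) (w : E3) = 1 → ⟪n, x u - x w⟫ ≤ P.2.2.1) ∧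
  (∀ n ∈ D, ∀ u v : ↥Pat, dist (u : E3) (v : E3) = Real.sqrt 2 → ∀ w : ↥Pat, SqVert u v w → ⟪n, c u v - x w⟫ ≤ P.2.2.2)

/-- **`RungLP(Pat, Din → Dout, Γ, θ, ρ, P → Q)` — THE FINITE LINEAR STATEMENT A RUNG CERTIFICATE PROVES.**
Unknowns: shell residuals `x : Pat → E3`, cap residuals `c : Pat → Pat → E3` (slot `(u,v)`, `dist u v = √2`), shell scale ratios
`s u = nn_{τu}/nn_i`, cap scale ratios `t u v = nn_m/nn_i`.  Hypotheses — each one LINEAR in the atoms (coordinates of `x`, `c`; `s`, `t`, `s²`,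
`t²`; `‖δ‖²` per bond), and each one PROVABLY extracted from the bond-graph semantics by `gRungAt_of_rungLP` (§3):
the input fit `DirFit Din P x c`; the gauge `Γ x`; the scale boxes; for every bond and BOTH of its endpoints the two window rows
`Rows θ s (bondSq e δ)` — radial bonds (`e = u`, `δ = x u`, endpoints centre `s = 1` and `u`), the 24 link bonds (`e = u − w`, `δ = x u − x w`;
the row at the endpoint `w` is the instance `(w, u)`), the cap bonds (`e = u + v − w`, `δ = c u v − x w`, endpoints cap and `w`); and the quadratic
SLACK `‖δ‖² ≤ (ρ·bound)²` of every residual / residual difference (the only place the covering constant `ρ` of `Din` enters; second order).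
Conclusion: the output fit `DirFit Dout Q x c`.
A certificate = per output inequality one vector of non-negative multipliers (LP duality); replay = `linear_combination` / `linarith`, exact
over `ℚ` once probes and pattern are written over `ℚ³/√2` (both kissing patterns lie in `ℤ³/√2` resp. `ℤ³/(3√2)`). -/
def RungLP (Pat : Finset E3) (Din Dout : List E3) (Γ : (↥Pat → E3) → Prop) (θ ρ : ℝ) (P Q : ℝ × ℝ × ℝ × ℝ) : Prop :=
  ∀ (x : ↥Pat → E3) (c : ↥Pat → ↥Pat → E3) (s : ↥Pat → ℝ) (t : ↥Pat → ↥Pat → ℝ),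
    DirFit Din P x c → Γ x →
    (∀ u : ↥Pat, ScaleBox (1 + θ) (s u)) →
    (∀ u v : ↥Pat, dist (u : E3) (v : E3) = Real.sqrt 2 → ScaleBox ((1 + θ) ^ 2) (t u v)) →
    (∀ u : ↥Pat, Rows θ 1 (bondSq u (x u)) ∧ Rows θ (s u) (bondSq u (x u))) →
    (∀ u w : ↥Pat, dist (u : E3) (w : E3) = 1 → Rows θ (s u) (bondSq ((u : E3) - w) (x u - x w))) →
    (∀ u v : ↥Pat, dist (u : E3) (v : E3) = Real.sqrt 2 → ∀ w : ↥Pat, SqVert u v w →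
        Rows θ (t u v) (bondSq ((u : E3) + v - w) (c u v - x w)) ∧ Rows θ (s w) (bondSq ((u : E3) + v - w) (c u v - x w))) →
    (∀ u : ↥Pat, ‖x u‖ ^ 2 ≤ (ρ * P.1) ^ 2) →
    (∀ u v : ↥Pat, dist (u : E3) (v : E3) = Real.sqrt 2 → ‖c u v‖ ^ 2 ≤ (ρ * P.2.1) ^ 2) →
    (∀ u w : ↥Pat, dist (u : E3) (w : E3) = 1 → ‖x u - x w‖ ^ 2 ≤ (ρ * P.2.2.1) ^ 2) →
    (∀ u v : ↥Pat, dist (u : E3) (v : E3) = Real.sqrt 2 → ∀ w : ↥Pat, SqVert u v w → ‖c u v - x w‖ ^ 2 ≤ (ρ * P.2.2.2) ^ 2) →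
    DirFit Dout Q x c

/-- The COVERING CONSTANT of a probe set: `‖v‖ ≤ ρ · max_{n ∈ D} ⟪n, v⟫` for every `v` (i.e. the polar body `{v | ⟪n,v⟫ ≤ 1 ∀ n ∈ D}` lies
in the ball of radius `ρ`).  `ρ = √3` for the six axis probes, `1.1281` for the 26 probes of type `(100), (110), (111)`. -/
def Covers (D : List E3) (ρ : ℝ) : Prop := ∀ v : E3, ∃ n ∈ D, ‖v‖ ≤ ρ * ⟪n, v⟫

end Summit.AtomisticToContinuum.Crystallization.Theorems.FrustratedLawDichotomyTwoShellRigidityGaugedLadder
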